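import Literature.Topology.FourManifolds.CappellShanesonClassGroupThirtysix
import Literature.Topology.FourManifolds.CappellShanesonClassGroupThirtysixCls
import Literature.Topology.FourManifolds.CappellShanesonTotallyReal
import Literature.Topology.FourManifolds.CappellShanesonClassGroupTwelve
import Literature.Topology.FourManifolds.CappellShanesonClassGroupFifteen
import HarnessLib

/-!
# Trace `36`: the class group, the cover of `C(ℤ[Θ₃₆])`, Gompf's conjecture for the traces `36` and `-31`

Part 'Main' of the certified class-group computation for the trace `36` field behind
Kim–Yamada's Theorem B (`GompfConjectureForTrace 36` and, by Theorem A, `-31`), serving the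
named fact
`Literature.Topology.FourManifolds.kimYamada2023_nonempty_diffeomorph_sphere_four_of_trace_mem_Icc`
(`CappellShaneson.lean`; M. H. Kim, S. Yamada, Kyungpook Math. J. 63 (2023) 373–411 =
arXiv:1707.03860, Cor. C). The computation is split over several files only because of the
proposal size limit: `…ClassGroupThirtysix.lean` (discriminant, `𝓞 K = ℤ[θ]`, the primes of small norm), `…ClassGroupThirtysixRel<k>.lean` (two-ideal relations with certified generators and the non-vanishing of the generators), `…ClassGroupThirtysixCls.lean` (the class of every small prime in terms of the generator(s), the order relations), `…ClassGroupThirtysixMain.lean` (generation of the class group by Minkowski's bound, the cover of `C(ℤ[Θ])` by standard-matrix representatives, Gompf's conjecture for the two traces). (File generated from a certified computation; every relation is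
checked by the Lean kernel; no named fact is introduced, D-0026.)

## References

* [KimYamada2023] M. H. Kim, S. Yamada, Kyungpook Math. J. 63 (2023) 373–411 (arXiv:1707.03860):
  §2.3 (Prop. 2.14), §6.1 (Lemma 6.1 and the proof of Thm. B), Thm. A.
* [Marcus2018] D. A. Marcus, *Number Fields*, 2nd ed., Ch. 3, Thm. 27 (Dedekind–Kummer); Ch. 5,
  Cor. 2 of Thm. 37 (Minkowski bound) and the class-group computations after it.
-/

noncomputable section

open Set Polynomial Module NumberField Ideal
open scoped NumberField MatrixGroups nonZeroDivisors
open Literature.LinearAlgebra.Matrix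

namespace Literature.Topology.FourManifolds

section Field

variable {K : Type*} [Field K] [NumberField K] {θ : K}

set_option maxHeartbeats 2000000 in
/-- **Every ideal class of the trace `36` field is a power `aʳ`, `0 ≤ r < 5`, of `a = [(11, θ - 7)]`,
represented by the ideals listed** (so the class number divides `5`). Proof: `d_K = 1252129`,
`⌊M_K⌋ ≤ 248`, Dedekind–Kummer at `p ≤ 248`, and the class of every small prime computed above
from two-ideal relations with certified generators. [cite: KimYamada2023, §6.1 (proof of Thm. B)] -/
theorem classGroup_mem_thirtysix (hθ : aeval θ (csPoly 36) = 0) (h3 : finrank ℚ K = 3)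
    (C : ClassGroup (𝓞 K)) :
    C = 1 ∨
      C = ClassGroup.mk0 ⟨span {(11 : 𝓞 K), thetaInt hθ - 7}, (span_pair_ofNat_mem_nonZeroDivisors (nat_lit 11) (thetaInt hθ - 7))⟩ ∨
      C = ClassGroup.mk0 ⟨span {(13 : 𝓞 K), thetaInt hθ - 6}, (span_pair_ofNat_mem_nonZeroDivisors (nat_lit 13) (thetaInt hθ - 6))⟩ ∨
      C = ClassGroup.mk0 ⟨span {(17 : 𝓞 K), thetaInt hθ - 8}, (span_pair_ofNat_mem_nonZeroDivisors (nat_lit 17) (thetaInt hθ - 8))⟩ ∨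
      C = ClassGroup.mk0 ⟨span {(19 : 𝓞 K), thetaInt hθ - 11}, (span_pair_ofNat_mem_nonZeroDivisors (nat_lit 19) (thetaInt hθ - 11))⟩ := by
  classical
  obtain ⟨a, ha⟩ : ∃ a : ClassGroup (𝓞 K), ClassGroup.mk0 ⟨span {(11 : 𝓞 K), thetaInt hθ - 7}, (span_pair_ofNat_mem_nonZeroDivisors (nat_lit 11) (thetaInt hθ - 7))⟩ = a := ⟨_, rfl⟩
  have ham : a ^ (5 : ℤ) = 1 := by rw [← ha]; exact pow_order_thirtysix hθ
  let H : Subgroup (ClassGroup (𝓞 K)) := Subgroup.zpowers a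
  have hprinc : ∀ (P : Ideal (𝓞 K)) (hP0 : P ∈ (Ideal (𝓞 K))⁰) (x : 𝓞 K), P = span {x} →
      ClassGroup.mk0 ⟨P, hP0⟩ ∈ H := by
    intro P hP0 x hPx
    have : ClassGroup.mk0 ⟨P, hP0⟩ = 1 :=
      (ClassGroup.mk0_eq_one_iff hP0).mpr ⟨⟨x, by rw [hPx, submodule_span_eq]⟩⟩
    rw [this]
    exact H.one_mem
  -- Minkowski: `⌊M_K⌋ ≤ 248`
  have hd : ((|NumberField.discr K| : ℤ) : ℝ) ≤ (1252129 : ℕ) := by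
    rw [discr_eq_thirtysix hθ h3]
    norm_num
  have hfloor := floor_minkowskiBound_le_cubic_real h3 (nrComplexPlaces_eq_zero_of_csPoly hθ h3 (by norm_num))
    hd (s := 1119) (U := 248) (by norm_num) (by norm_num) (by norm_num)
  have htop : H = ⊤ := by
    refine classGroup_subgroup_eq_top_of_primesOver H hfloor fun p hp hprime P hP0 hP hle => ?_
    have hpU : p ≤ 248 := (Finset.mem_Icc.mp hp).2
    have h1p : 1 ≤ p := (Finset.mem_Icc.mp hp).1
    interval_cases p
    · exact absurd hprime (by norm_num)
    · exact hprinc P hP0 _ (eq_span_of_inert_thirtysix hθ h3 (by norm_num) hP)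
    · exact hprinc P hP0 _ (eq_span_of_inert_thirtysix hθ h3 (by norm_num) hP)
    · exact absurd hprime (by norm_num)
    · exact hprinc P hP0 _ (eq_span_of_inert_thirtysix hθ h3 (by norm_num) hP)
    · exact absurd hprime (by norm_num)
    · exact hprinc P hP0 _ (eq_span_of_inert_thirtysix hθ h3 (by norm_num) hP)
    · exact absurd hprime (by norm_num)
    · exact absurd hprime (by norm_num)
    · exact absurd hprime (by norm_num)
    · -- `p = 11`
      rcases eq_P11_or_eq_Q11_thirtysix hθ h3 hP with h | h <;> subst h
      · rw [show ClassGroup.mk0 ⟨_, hP0⟩ = ClassGroup.mk0 ⟨span {(11 : 𝓞 K), thetaInt hθ - 7}, (span_pair_ofNat_mem_nonZeroDivisors (nat_lit 11) (thetaInt hθ - 7))⟩ from rfl, ha]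
        exact Subgroup.mem_zpowers a
      · exact mem_zpowers_of_mk0_eq a (cls_Q11_thirtysix hθ) ha
    · exact absurd hprime (by norm_num)
    · -- `p = 13`
      rcases eq_P13_or_eq_Q13_thirtysix hθ h3 hP with h | h <;> subst h
      · exact mem_zpowers_of_mk0_eq a (cls_P13_6_thirtysix hθ) ha
      · exact mem_zpowers_of_mk0_eq a (cls_Q13_thirtysix hθ) ha
    · exact absurd hprime (by norm_num)
    · exact absurd hprime (by norm_num)
    · exact absurd hprime (by norm_num)
    · -- `p = 17`
      have h := eq_span_pair_of_unique_root_thirtysix hθ h3 (Or.inl ⟨rfl, rfl⟩) hP hle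
      simp only [Nat.cast_ofNat, Int.cast_ofNat] at h
      subst h
      exact mem_zpowers_of_mk0_eq a (cls_P17_8_thirtysix hθ) ha
    · exact absurd hprime (by norm_num)
    · -- `p = 19`
      have h := eq_span_pair_of_unique_root_thirtysix hθ h3 (Or.inr (Or.inl ⟨rfl, rfl⟩)) hP hle
      simp only [Nat.cast_ofNat, Int.cast_ofNat] at h
      subst h
      exact mem_zpowers_of_mk0_eq a (cls_P19_11_thirtysix hθ) ha
    · exact absurd hprime (by norm_num)
    · exact absurd hprime (by norm_num)
    · exact absurd hprime (by norm_num)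
    · exact hprinc P hP0 _ (eq_span_of_inert_thirtysix hθ h3 (by norm_num) hP)
    · exact absurd hprime (by norm_num)
    · exact absurd hprime (by norm_num)
    · exact absurd hprime (by norm_num)
    · exact absurd hprime (by norm_num)
    · exact absurd hprime (by norm_num)
    · exact hprinc P hP0 _ (eq_span_of_inert_thirtysix hθ h3 (by norm_num) hP)
    · exact absurd hprime (by norm_num)
    · exact hprinc P hP0 _ (eq_span_of_inert_thirtysix hθ h3 (by norm_num) hP)
    · exact absurd hprime (by norm_num)
    · exact absurd hprime (by norm_num)
    · exact absurd hprime (by norm_num)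
    · exact absurd hprime (by norm_num)
    · exact absurd hprime (by norm_num)
    · exact hprinc P hP0 _ (eq_span_of_inert_thirtysix hθ h3 (by norm_num) hP)
    · exact absurd hprime (by norm_num)
    · exact absurd hprime (by norm_num)
    · exact absurd hprime (by norm_num)
    · -- `p = 41`
      have h := eq_span_pair_of_unique_root_thirtysix hθ h3 (Or.inr (Or.inr (Or.inl ⟨rfl, rfl⟩))) hP hle
      simp only [Nat.cast_ofNat, Int.cast_ofNat] at h
      subst h
      exact mem_zpowers_of_mk0_eq a (cls_P41_27_thirtysix hθ) ha
    · exact absurd hprime (by norm_num)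
    · -- `p = 43`
      have h := eq_span_pair_of_unique_root_thirtysix hθ h3 (Or.inr (Or.inr (Or.inr (Or.inl ⟨rfl, rfl⟩)))) hP hle
      simp only [Nat.cast_ofNat, Int.cast_ofNat] at h
      subst h
      exact mem_zpowers_of_mk0_eq a (cls_P43_18_thirtysix hθ) ha
    · exact absurd hprime (by norm_num)
    · exact absurd hprime (by norm_num)
    · exact absurd hprime (by norm_num)
    · exact hprinc P hP0 _ (eq_span_of_inert_thirtysix hθ h3 (by norm_num) hP)
    · exact absurd hprime (by norm_num)
    · exact absurd hprime (by norm_num)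
    · exact absurd hprime (by norm_num)
    · exact absurd hprime (by norm_num)
    · exact absurd hprime (by norm_num)
    · exact hprinc P hP0 _ (eq_span_of_inert_thirtysix hθ h3 (by norm_num) hP)
    · exact absurd hprime (by norm_num)
    · exact absurd hprime (by norm_num)
    · exact absurd hprime (by norm_num)
    · exact absurd hprime (by norm_num)
    · exact absurd hprime (by norm_num)
    · -- `p = 59`
      have h := eq_span_pair_of_unique_root_thirtysix hθ h3 (Or.inr (Or.inr (Or.inr (Or.inr (Or.inl ⟨rfl, rfl⟩))))) hP hle
      simp only [Nat.cast_ofNat, Int.cast_ofNat] at h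
      subst h
      exact mem_zpowers_of_mk0_eq a (cls_P59_17_thirtysix hθ) ha
    · exact absurd hprime (by norm_num)
    · -- `p = 61`
      have h := eq_span_pair_of_unique_root_thirtysix hθ h3 (Or.inr (Or.inr (Or.inr (Or.inr (Or.inr (Or.inl ⟨rfl, rfl⟩)))))) hP hle
      simp only [Nat.cast_ofNat, Int.cast_ofNat] at h
      subst h
      exact hprinc _ hP0 _ (P61_31_eq_thirtysix hθ)
    · exact absurd hprime (by norm_num)
    · exact absurd hprime (by norm_num)
    · exact absurd hprime (by norm_num)
    · exact absurd hprime (by norm_num)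
    · exact absurd hprime (by norm_num)
    · -- `p = 67` (splits)
      rcases eq_P67_thirtysix hθ h3 hP with h | h | h <;> subst h
      · exact hprinc _ hP0 _ (P67_2_eq_thirtysix hθ)
      · exact mem_zpowers_of_mk0_eq a (cls_P67_6_thirtysix hθ) ha
      · exact mem_zpowers_of_mk0_eq a (cls_P67_28_thirtysix hθ) ha
    · exact absurd hprime (by norm_num)
    · exact absurd hprime (by norm_num)
    · exact absurd hprime (by norm_num)
    · -- `p = 71`
      have h := eq_span_pair_of_unique_root_thirtysix hθ h3 (Or.inr (Or.inr (Or.inr (Or.inr (Or.inr (Or.inr (Or.inl ⟨rfl, rfl⟩))))))) hP hle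
      simp only [Nat.cast_ofNat, Int.cast_ofNat] at h
      subst h
      exact mem_zpowers_of_mk0_eq a (cls_P71_67_thirtysix hθ) ha
    · exact absurd hprime (by norm_num)
    · -- `p = 73`
      have h := eq_span_pair_of_unique_root_thirtysix hθ h3 (Or.inr (Or.inr (Or.inr (Or.inr (Or.inr (Or.inr (Or.inr (Or.inl ⟨rfl, rfl⟩)))))))) hP hle
      simp only [Nat.cast_ofNat, Int.cast_ofNat] at h
      subst h
      exact hprinc _ hP0 _ (P73_72_eq_thirtysix hθ)
    · exact absurd hprime (by norm_num)
    · exact absurd hprime (by norm_num)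
    · exact absurd hprime (by norm_num)
    · exact absurd hprime (by norm_num)
    · exact absurd hprime (by norm_num)
    · -- `p = 79`
      have h := eq_span_pair_of_unique_root_thirtysix hθ h3 (Or.inr (Or.inr (Or.inr (Or.inr (Or.inr (Or.inr (Or.inr (Or.inr (Or.inl ⟨rfl, rfl⟩))))))))) hP hle
      simp only [Nat.cast_ofNat, Int.cast_ofNat] at h
      subst h
      exact mem_zpowers_of_mk0_eq a (cls_P79_28_thirtysix hθ) ha
    · exact absurd hprime (by norm_num)
    · exact absurd hprime (by norm_num)
    · exact absurd hprime (by norm_num)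
    · -- `p = 83`
      have h := eq_span_pair_of_unique_root_thirtysix hθ h3 (Or.inr (Or.inr (Or.inr (Or.inr (Or.inr (Or.inr (Or.inr (Or.inr (Or.inr (Or.inl ⟨rfl, rfl⟩)))))))))) hP hle
      simp only [Nat.cast_ofNat, Int.cast_ofNat] at h
      subst h
      exact mem_zpowers_of_mk0_eq a (cls_P83_17_thirtysix hθ) ha
    · exact absurd hprime (by norm_num)
    · exact absurd hprime (by norm_num)
    · exact absurd hprime (by norm_num)
    · exact absurd hprime (by norm_num)
    · exact absurd hprime (by norm_num)
    · -- `p = 89`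
      have h := eq_span_pair_of_unique_root_thirtysix hθ h3 (Or.inr (Or.inr (Or.inr (Or.inr (Or.inr (Or.inr (Or.inr (Or.inr (Or.inr (Or.inr (Or.inl ⟨rfl, rfl⟩))))))))))) hP hle
      simp only [Nat.cast_ofNat, Int.cast_ofNat] at h
      subst h
      exact mem_zpowers_of_mk0_eq a (cls_P89_8_thirtysix hθ) ha
    · exact absurd hprime (by norm_num)
    · exact absurd hprime (by norm_num)
    · exact absurd hprime (by norm_num)
    · exact absurd hprime (by norm_num)
    · exact absurd hprime (by norm_num)
    · exact absurd hprime (by norm_num)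
    · exact absurd hprime (by norm_num)
    · exact hprinc P hP0 _ (eq_span_of_inert_thirtysix hθ h3 (by norm_num) hP)
    · exact absurd hprime (by norm_num)
    · exact absurd hprime (by norm_num)
    · exact absurd hprime (by norm_num)
    · -- `p = 101`
      have h := eq_span_pair_of_unique_root_thirtysix hθ h3 (Or.inr (Or.inr (Or.inr (Or.inr (Or.inr (Or.inr (Or.inr (Or.inr (Or.inr (Or.inr (Or.inr (Or.inl ⟨rfl, rfl⟩)))))))))))) hP hle
      simp only [Nat.cast_ofNat, Int.cast_ofNat] at h
      subst h
      exact mem_zpowers_of_mk0_eq a (cls_P101_78_thirtysix hθ) ha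
    · exact absurd hprime (by norm_num)
    · exact hprinc P hP0 _ (eq_span_of_inert_thirtysix hθ h3 (by norm_num) hP)
    · exact absurd hprime (by norm_num)
    · exact absurd hprime (by norm_num)
    · exact absurd hprime (by norm_num)
    · -- `p = 107`
      have h := eq_span_pair_of_unique_root_thirtysix hθ h3 (Or.inr (Or.inr (Or.inr (Or.inr (Or.inr (Or.inr (Or.inr (Or.inr (Or.inr (Or.inr (Or.inr (Or.inr (Or.inl ⟨rfl, rfl⟩))))))))))))) hP hle
      simp only [Nat.cast_ofNat, Int.cast_ofNat] at h
      subst h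
      exact mem_zpowers_of_mk0_eq a (cls_P107_7_thirtysix hθ) ha
    · exact absurd hprime (by norm_num)
    · exact hprinc P hP0 _ (eq_span_of_inert_thirtysix hθ h3 (by norm_num) hP)
    · exact absurd hprime (by norm_num)
    · exact absurd hprime (by norm_num)
    · exact absurd hprime (by norm_num)
    · -- `p = 113`
      have h := eq_span_pair_of_unique_root_thirtysix hθ h3 (Or.inr (Or.inr (Or.inr (Or.inr (Or.inr (Or.inr (Or.inr (Or.inr (Or.inr (Or.inr (Or.inr (Or.inr (Or.inr (Or.inl ⟨rfl, rfl⟩)))))))))))))) hP hle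
      simp only [Nat.cast_ofNat, Int.cast_ofNat] at h
      subst h
      exact mem_zpowers_of_mk0_eq a (cls_P113_53_thirtysix hθ) ha
    · exact absurd hprime (by norm_num)
    · exact absurd hprime (by norm_num)
    · exact absurd hprime (by norm_num)
    · exact absurd hprime (by norm_num)
    · exact absurd hprime (by norm_num)
    · exact absurd hprime (by norm_num)
    · exact absurd hprime (by norm_num)
    · exact absurd hprime (by norm_num)
    · exact absurd hprime (by norm_num)
    · exact absurd hprime (by norm_num)
    · exact absurd hprime (by norm_num)
    · exact absurd hprime (by norm_num)
    · exact absurd hprime (by norm_num)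
    · exact hprinc P hP0 _ (eq_span_of_inert_thirtysix hθ h3 (by norm_num) hP)
    · exact absurd hprime (by norm_num)
    · exact absurd hprime (by norm_num)
    · exact absurd hprime (by norm_num)
    · -- `p = 131`
      have h := eq_span_pair_of_unique_root_thirtysix hθ h3 (Or.inr (Or.inr (Or.inr (Or.inr (Or.inr (Or.inr (Or.inr (Or.inr (Or.inr (Or.inr (Or.inr (Or.inr (Or.inr (Or.inr (Or.inl ⟨rfl, rfl⟩))))))))))))))) hP hle
      simp only [Nat.cast_ofNat, Int.cast_ofNat] at h
      subst h
      exact mem_zpowers_of_mk0_eq a (cls_P131_82_thirtysix hθ) ha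
    · exact absurd hprime (by norm_num)
    · exact absurd hprime (by norm_num)
    · exact absurd hprime (by norm_num)
    · exact absurd hprime (by norm_num)
    · exact absurd hprime (by norm_num)
    · -- `p = 137`
      have h := eq_span_pair_of_unique_root_thirtysix hθ h3 (Or.inr (Or.inr (Or.inr (Or.inr (Or.inr (Or.inr (Or.inr (Or.inr (Or.inr (Or.inr (Or.inr (Or.inr (Or.inr (Or.inr (Or.inr (Or.inl ⟨rfl, rfl⟩)))))))))))))))) hP hle
      simp only [Nat.cast_ofNat, Int.cast_ofNat] at h
      subst h
      exact mem_zpowers_of_mk0_eq a (cls_P137_27_thirtysix hθ) ha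
    · exact absurd hprime (by norm_num)
    · -- `p = 139`
      have h := eq_span_pair_of_unique_root_thirtysix hθ h3 (Or.inr (Or.inr (Or.inr (Or.inr (Or.inr (Or.inr (Or.inr (Or.inr (Or.inr (Or.inr (Or.inr (Or.inr (Or.inr (Or.inr (Or.inr (Or.inr (Or.inl ⟨rfl, rfl⟩))))))))))))))))) hP hle
      simp only [Nat.cast_ofNat, Int.cast_ofNat] at h
      subst h
      exact mem_zpowers_of_mk0_eq a (cls_P139_11_thirtysix hθ) ha
    · exact absurd hprime (by norm_num)
    · exact absurd hprime (by norm_num)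
    · exact absurd hprime (by norm_num)
    · exact absurd hprime (by norm_num)
    · exact absurd hprime (by norm_num)
    · exact absurd hprime (by norm_num)
    · exact absurd hprime (by norm_num)
    · exact absurd hprime (by norm_num)
    · exact absurd hprime (by norm_num)
    · exact hprinc P hP0 _ (eq_span_of_inert_thirtysix hθ h3 (by norm_num) hP)
    · exact absurd hprime (by norm_num)
    · exact hprinc P hP0 _ (eq_span_of_inert_thirtysix hθ h3 (by norm_num) hP)
    · exact absurd hprime (by norm_num)
    · exact absurd hprime (by norm_num)
    · exact absurd hprime (by norm_num)
    · exact absurd hprime (by norm_num)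
    · exact absurd hprime (by norm_num)
    · -- `p = 157`
      have h := eq_span_pair_of_unique_root_thirtysix hθ h3 (Or.inr (Or.inr (Or.inr (Or.inr (Or.inr (Or.inr (Or.inr (Or.inr (Or.inr (Or.inr (Or.inr (Or.inr (Or.inr (Or.inr (Or.inr (Or.inr (Or.inr (Or.inl ⟨rfl, rfl⟩)))))))))))))))))) hP hle
      simp only [Nat.cast_ofNat, Int.cast_ofNat] at h
      subst h
      exact mem_zpowers_of_mk0_eq a (cls_P157_123_thirtysix hθ) ha
    · exact absurd hprime (by norm_num)
    · exact absurd hprime (by norm_num)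
    · exact absurd hprime (by norm_num)
    · exact absurd hprime (by norm_num)
    · exact absurd hprime (by norm_num)
    · -- `p = 163` (splits)
      rcases eq_P163_thirtysix hθ h3 hP with h | h | h <;> subst h
      · exact mem_zpowers_of_mk0_eq a (cls_P163_96_thirtysix hθ) ha
      · exact mem_zpowers_of_mk0_eq a (cls_P163_111_thirtysix hθ) ha
      · exact mem_zpowers_of_mk0_eq a (cls_P163_155_thirtysix hθ) ha
    · exact absurd hprime (by norm_num)
    · exact absurd hprime (by norm_num)
    · exact absurd hprime (by norm_num)
    · exact hprinc P hP0 _ (eq_span_of_inert_thirtysix hθ h3 (by norm_num) hP)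
    · exact absurd hprime (by norm_num)
    · exact absurd hprime (by norm_num)
    · exact absurd hprime (by norm_num)
    · exact absurd hprime (by norm_num)
    · exact absurd hprime (by norm_num)
    · -- `p = 173`
      have h := eq_span_pair_of_unique_root_thirtysix hθ h3 (Or.inr (Or.inr (Or.inr (Or.inr (Or.inr (Or.inr (Or.inr (Or.inr (Or.inr (Or.inr (Or.inr (Or.inr (Or.inr (Or.inr (Or.inr (Or.inr (Or.inr (Or.inr (Or.inl ⟨rfl, rfl⟩))))))))))))))))))) hP hle
      simp only [Nat.cast_ofNat, Int.cast_ofNat] at h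
      subst h
      exact mem_zpowers_of_mk0_eq a (cls_P173_81_thirtysix hθ) ha
    · exact absurd hprime (by norm_num)
    · exact absurd hprime (by norm_num)
    · exact absurd hprime (by norm_num)
    · exact absurd hprime (by norm_num)
    · exact absurd hprime (by norm_num)
    · -- `p = 179`
      have h := eq_span_pair_of_unique_root_thirtysix hθ h3 (Or.inr (Or.inr (Or.inr (Or.inr (Or.inr (Or.inr (Or.inr (Or.inr (Or.inr (Or.inr (Or.inr (Or.inr (Or.inr (Or.inr (Or.inr (Or.inr (Or.inr (Or.inr (Or.inr (Or.inl ⟨rfl, rfl⟩)))))))))))))))))))) hP hle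
      simp only [Nat.cast_ofNat, Int.cast_ofNat] at h
      subst h
      exact hprinc _ hP0 _ (P179_120_eq_thirtysix hθ)
    · exact absurd hprime (by norm_num)
    · -- `p = 181` (splits)
      rcases eq_P181_thirtysix hθ h3 hP with h | h | h <;> subst h
      · exact mem_zpowers_of_mk0_eq a (cls_P181_103_thirtysix hθ) ha
      · exact hprinc _ hP0 _ (P181_121_eq_thirtysix hθ)
      · exact mem_zpowers_of_mk0_eq a (cls_P181_174_thirtysix hθ) ha
    · exact absurd hprime (by norm_num)
    · exact absurd hprime (by norm_num)
    · exact absurd hprime (by norm_num)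
    · exact absurd hprime (by norm_num)
    · exact absurd hprime (by norm_num)
    · exact absurd hprime (by norm_num)
    · exact absurd hprime (by norm_num)
    · exact absurd hprime (by norm_num)
    · exact absurd hprime (by norm_num)
    · -- `p = 191`
      have h := eq_span_pair_of_unique_root_thirtysix hθ h3 (Or.inr (Or.inr (Or.inr (Or.inr (Or.inr (Or.inr (Or.inr (Or.inr (Or.inr (Or.inr (Or.inr (Or.inr (Or.inr (Or.inr (Or.inr (Or.inr (Or.inr (Or.inr (Or.inr (Or.inr (Or.inl ⟨rfl, rfl⟩))))))))))))))))))))) hP hle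
      simp only [Nat.cast_ofNat, Int.cast_ofNat] at h
      subst h
      exact mem_zpowers_of_mk0_eq a (cls_P191_80_thirtysix hθ) ha
    · exact absurd hprime (by norm_num)
    · -- `p = 193` (splits)
      rcases eq_P193_thirtysix hθ h3 hP with h | h | h <;> subst h
      · exact hprinc _ hP0 _ (P193_3_eq_thirtysix hθ)
      · exact mem_zpowers_of_mk0_eq a (cls_P193_68_thirtysix hθ) ha
      · exact mem_zpowers_of_mk0_eq a (cls_P193_158_thirtysix hθ) ha
    · exact absurd hprime (by norm_num)
    · exact absurd hprime (by norm_num)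
    · exact absurd hprime (by norm_num)
    · -- `p = 197`
      have h := eq_span_pair_of_unique_root_thirtysix hθ h3 (Or.inr (Or.inr (Or.inr (Or.inr (Or.inr (Or.inr (Or.inr (Or.inr (Or.inr (Or.inr (Or.inr (Or.inr (Or.inr (Or.inr (Or.inr (Or.inr (Or.inr (Or.inr (Or.inr (Or.inr (Or.inr (Or.inl ⟨rfl, rfl⟩)))))))))))))))))))))) hP hle
      simp only [Nat.cast_ofNat, Int.cast_ofNat] at h
      subst h
      exact mem_zpowers_of_mk0_eq a (cls_P197_113_thirtysix hθ) ha
    · exact absurd hprime (by norm_num)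
    · -- `p = 199`
      have h := eq_span_pair_of_unique_root_thirtysix hθ h3 (Or.inr (Or.inr (Or.inr (Or.inr (Or.inr (Or.inr (Or.inr (Or.inr (Or.inr (Or.inr (Or.inr (Or.inr (Or.inr (Or.inr (Or.inr (Or.inr (Or.inr (Or.inr (Or.inr (Or.inr (Or.inr (Or.inr (Or.inl ⟨rfl, rfl⟩))))))))))))))))))))))) hP hle
      simp only [Nat.cast_ofNat, Int.cast_ofNat] at h
      subst h
      exact mem_zpowers_of_mk0_eq a (cls_P199_106_thirtysix hθ) ha
    · exact absurd hprime (by norm_num)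
    · exact absurd hprime (by norm_num)
    · exact absurd hprime (by norm_num)
    · exact absurd hprime (by norm_num)
    · exact absurd hprime (by norm_num)
    · exact absurd hprime (by norm_num)
    · exact absurd hprime (by norm_num)
    · exact absurd hprime (by norm_num)
    · exact absurd hprime (by norm_num)
    · exact absurd hprime (by norm_num)
    · exact absurd hprime (by norm_num)
    · exact hprinc P hP0 _ (eq_span_of_inert_thirtysix hθ h3 (by norm_num) hP)
    · exact absurd hprime (by norm_num)
    · exact absurd hprime (by norm_num)
    · exact absurd hprime (by norm_num)
    · exact absurd hprime (by norm_num)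
    · exact absurd hprime (by norm_num)
    · exact absurd hprime (by norm_num)
    · exact absurd hprime (by norm_num)
    · exact absurd hprime (by norm_num)
    · exact absurd hprime (by norm_num)
    · exact absurd hprime (by norm_num)
    · exact absurd hprime (by norm_num)
    · -- `p = 223`
      have h := eq_span_pair_of_unique_root_thirtysix hθ h3 (Or.inr (Or.inr (Or.inr (Or.inr (Or.inr (Or.inr (Or.inr (Or.inr (Or.inr (Or.inr (Or.inr (Or.inr (Or.inr (Or.inr (Or.inr (Or.inr (Or.inr (Or.inr (Or.inr (Or.inr (Or.inr (Or.inr (Or.inr (Or.inl ⟨rfl, rfl⟩)))))))))))))))))))))))) hP hle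
      simp only [Nat.cast_ofNat, Int.cast_ofNat] at h
      subst h
      exact hprinc _ hP0 _ (P223_221_eq_thirtysix hθ)
    · exact absurd hprime (by norm_num)
    · exact absurd hprime (by norm_num)
    · exact absurd hprime (by norm_num)
    · -- `p = 227`
      have h := eq_span_pair_of_unique_root_thirtysix hθ h3 (Or.inr (Or.inr (Or.inr (Or.inr (Or.inr (Or.inr (Or.inr (Or.inr (Or.inr (Or.inr (Or.inr (Or.inr (Or.inr (Or.inr (Or.inr (Or.inr (Or.inr (Or.inr (Or.inr (Or.inr (Or.inr (Or.inr (Or.inr (Or.inr (⟨rfl, rfl⟩))))))))))))))))))))))))) hP hle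
      simp only [Nat.cast_ofNat, Int.cast_ofNat] at h
      subst h
      exact mem_zpowers_of_mk0_eq a (cls_P227_143_thirtysix hθ) ha
    · exact absurd hprime (by norm_num)
    · -- `p = 229` (splits)
      rcases eq_P229_thirtysix hθ h3 hP with h | h | h <;> subst h
      · exact mem_zpowers_of_mk0_eq a (cls_P229_30_thirtysix hθ) ha
      · exact mem_zpowers_of_mk0_eq a (cls_P229_32_thirtysix hθ) ha
      · exact mem_zpowers_of_mk0_eq a (cls_P229_203_thirtysix hθ) ha
    · exact absurd hprime (by norm_num)
    · exact absurd hprime (by norm_num)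
    · exact absurd hprime (by norm_num)
    · -- `p = 233` (splits)
      rcases eq_P233_thirtysix hθ h3 hP with h | h | h <;> subst h
      · exact mem_zpowers_of_mk0_eq a (cls_P233_76_thirtysix hθ) ha
      · exact mem_zpowers_of_mk0_eq a (cls_P233_202_thirtysix hθ) ha
      · exact mem_zpowers_of_mk0_eq a (cls_P233_224_thirtysix hθ) ha
    · exact absurd hprime (by norm_num)
    · exact absurd hprime (by norm_num)
    · exact absurd hprime (by norm_num)
    · exact absurd hprime (by norm_num)
    · exact absurd hprime (by norm_num)
    · exact hprinc P hP0 _ (eq_span_of_inert_thirtysix hθ h3 (by norm_num) hP)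
    · exact absurd hprime (by norm_num)
    · exact hprinc P hP0 _ (eq_span_of_inert_thirtysix hθ h3 (by norm_num) hP)
    · exact absurd hprime (by norm_num)
    · exact absurd hprime (by norm_num)
    · exact absurd hprime (by norm_num)
    · exact absurd hprime (by norm_num)
    · exact absurd hprime (by norm_num)
    · exact absurd hprime (by norm_num)
    · exact absurd hprime (by norm_num)
  have hC : C ∈ H := by rw [htop]; exact Subgroup.mem_top C
  obtain ⟨k, rfl⟩ := Subgroup.mem_zpowers_iff.mp hC
  obtain ⟨q, r, hr, rfl⟩ : ∃ q r : ℤ, (r = 0 ∨ r = 1 ∨ r = 2 ∨ r = 3 ∨ r = 4) ∧ k = 5 * q + r :=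
    ⟨k / 5, k % 5, by omega, by omega⟩
  rw [zpow_add, zpow_mul, ham, one_zpow, one_mul]
  rcases hr with rfl | rfl | rfl | rfl | rfl
  · exact Or.inl (zpow_zero a)
  · right; left
    rw [show (1 : ℤ) = 1 + 5 * (0) by norm_num, zpow_add, zpow_mul, ham, one_zpow, mul_one,
      zpow_one, ← ha]
  · right; right; left
    rw [show (2 : ℤ) = 2 + 5 * (0) by norm_num, zpow_add, zpow_mul, ham, one_zpow, mul_one,
      ← ha, ← cls_P13_6_thirtysix hθ]
  · right; right; right; left
    rw [show (3 : ℤ) = -2 + 5 * (1) by norm_num, zpow_add, zpow_mul, ham, one_zpow, mul_one,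
      ← ha, ← cls_P17_8_thirtysix hθ]
  · right; right; right; right
    rw [show (4 : ℤ) = -1 + 5 * (1) by norm_num, zpow_add, zpow_mul, ham, one_zpow, mul_one,
      ← ha, ← cls_P19_11_thirtysix hθ]


end Field


/-! ### The ideal classes of `ℤ[X]/(f₃₆)` and Gompf's conjecture for the traces `36` and `-31` -/

section Matrices

set_option maxHeartbeats 1000000 in
/-- **The ideal classes of `ℤ[Θ₃₆] = ℤ[X]/(f₃₆)`**: every non-zero ideal is in the class of one of
`⟨Θ - 1, 1⟩`, `⟨Θ - 7, 11⟩`, `⟨Θ - 6, 13⟩`, `⟨Θ - 8, 17⟩`, `⟨Θ - 11, 19⟩` (these representatives cover `C(ℤ[Θ₃₆])`). [cite: KimYamada2023, §6.1 (proof of Thm. B)] -/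
theorem ideal_class_adjoinRoot_thirtysix (J : Ideal (AdjoinRoot (csPoly 36))) (hJ : J ≠ ⊥) :
    ∃ x y : AdjoinRoot (csPoly 36), x ≠ 0 ∧ y ≠ 0 ∧
      (span {x} * J = span {y} * csIdeal 1 1 36 ∨ span {x} * J = span {y} * csIdeal 7 11 36 ∨ span {x} * J = span {y} * csIdeal 6 13 36 ∨ span {x} * J = span {y} * csIdeal 8 17 36 ∨ span {x} * J = span {y} * csIdeal 11 19 36) := by
  classical
  set θ' := AdjoinRoot.root (csPolyQ 36) with hθ'
  have hθ : aeval θ' (csPoly 36) = 0 := aeval_root_csPoly 36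
  have h3 : finrank ℚ (CSField 36) = 3 := finrank_CSField 36
  obtain ⟨e, he⟩ := exists_ringEquiv_adjoinRoot_of_sq hθ h3 csDisc_thirtysix_sq
  set I : Ideal (𝓞 (CSField 36)) := J.map e with hI
  have hIJ : I.map (e.symm : 𝓞 (CSField 36) →+* AdjoinRoot (csPoly 36)) = J := by
    rw [hI]
    exact Ideal.map_of_equiv e (I := J)
  have hI0 : I ≠ ⊥ := by
    intro h0
    apply hJ
    rw [← hIJ, h0, Ideal.map_bot]
  have hImem : I ∈ (Ideal (𝓞 (CSField 36)))⁰ := mem_nonZeroDivisors_iff_ne_zero.mpr hI0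
  have hsymm : ∀ x, (e.symm : 𝓞 (CSField 36) →+* AdjoinRoot (csPoly 36)) (e x) = x :=
    fun x => e.symm_apply_apply x
  have hP11_7 : (span {(11 : 𝓞 (CSField 36)), thetaInt hθ - 7}).map
      (e.symm : 𝓞 (CSField 36) →+* AdjoinRoot (csPoly 36)) = csIdeal 7 11 36 := by
    rw [Ideal.map_span, Set.image_insert_eq, Set.image_singleton, map_sub, ← he, hsymm, map_ofNat,
      map_ofNat, csIdeal, Set.pair_comm]
    simp
  have hP13_6 : (span {(13 : 𝓞 (CSField 36)), thetaInt hθ - 6}).map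
      (e.symm : 𝓞 (CSField 36) →+* AdjoinRoot (csPoly 36)) = csIdeal 6 13 36 := by
    rw [Ideal.map_span, Set.image_insert_eq, Set.image_singleton, map_sub, ← he, hsymm, map_ofNat,
      map_ofNat, csIdeal, Set.pair_comm]
    simp
  have hP17_8 : (span {(17 : 𝓞 (CSField 36)), thetaInt hθ - 8}).map
      (e.symm : 𝓞 (CSField 36) →+* AdjoinRoot (csPoly 36)) = csIdeal 8 17 36 := by
    rw [Ideal.map_span, Set.image_insert_eq, Set.image_singleton, map_sub, ← he, hsymm, map_ofNat,
      map_ofNat, csIdeal, Set.pair_comm]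
    simp
  have hP19_11 : (span {(19 : 𝓞 (CSField 36)), thetaInt hθ - 11}).map
      (e.symm : 𝓞 (CSField 36) →+* AdjoinRoot (csPoly 36)) = csIdeal 11 19 36 := by
    rw [Ideal.map_span, Set.image_insert_eq, Set.image_singleton, map_sub, ← he, hsymm, map_ofNat,
      map_ofNat, csIdeal, Set.pair_comm]
    simp
  have hcase : ∀ (P : Ideal (𝓞 (CSField 36))) (hP0 : P ∈ (Ideal (𝓞 (CSField 36)))⁰)
      (Q : Ideal (AdjoinRoot (csPoly 36))),
      P.map (e.symm : 𝓞 (CSField 36) →+* AdjoinRoot (csPoly 36)) = Q →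
      ClassGroup.mk0 ⟨I, hImem⟩ = ClassGroup.mk0 ⟨P, hP0⟩ →
        ∃ x y : AdjoinRoot (csPoly 36), x ≠ 0 ∧ y ≠ 0 ∧ span {x} * J = span {y} * Q := by
    intro P hP0 Q hPQ hcls
    obtain ⟨x, y, hx, hy, hxy⟩ := ClassGroup.mk0_eq_mk0_iff.mp hcls
    refine ⟨(e.symm : 𝓞 (CSField 36) →+* AdjoinRoot (csPoly 36)) x,
      (e.symm : 𝓞 (CSField 36) →+* AdjoinRoot (csPoly 36)) y,
      (map_ne_zero_iff _ e.symm.injective).mpr hx, (map_ne_zero_iff _ e.symm.injective).mpr hy, ?_⟩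
    have h := congrArg (Ideal.map (e.symm : 𝓞 (CSField 36) →+* AdjoinRoot (csPoly 36))) hxy
    simp only [Ideal.map_mul, Ideal.map_span, Set.image_singleton] at h
    rw [hIJ, hPQ] at h
    exact h
  rcases classGroup_mem_thirtysix hθ h3 (ClassGroup.mk0 ⟨I, hImem⟩) with h1 | hcl | hcl | hcl | hcl
  · obtain ⟨z, hz⟩ := ((ClassGroup.mk0_eq_one_iff hImem).mp h1).principal
    have hz' : I = span {z} := by rw [hz, submodule_span_eq]
    have hz0 : z ≠ 0 := by
      rintro rfl
      apply hI0
      rw [hz', Ideal.span_singleton_eq_bot]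
    refine ⟨1, (e.symm : 𝓞 (CSField 36) →+* AdjoinRoot (csPoly 36)) z, one_ne_zero,
      (map_ne_zero_iff _ e.symm.injective).mpr hz0, Or.inl ?_⟩
    rw [Ideal.span_singleton_one, Ideal.top_mul, csIdeal_one_one, Ideal.mul_top, ← hIJ, hz',
      Ideal.map_span, Set.image_singleton]
  · obtain ⟨x, y, hx, hy, h⟩ := hcase _ _ _ hP11_7 hcl
    exact ⟨x, y, hx, hy, Or.inr (Or.inl h)⟩
  · obtain ⟨x, y, hx, hy, h⟩ := hcase _ _ _ hP13_6 hcl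
    exact ⟨x, y, hx, hy, Or.inr (Or.inr (Or.inl h))⟩
  · obtain ⟨x, y, hx, hy, h⟩ := hcase _ _ _ hP17_8 hcl
    exact ⟨x, y, hx, hy, Or.inr (Or.inr (Or.inr (Or.inl h)))⟩
  · obtain ⟨x, y, hx, hy, h⟩ := hcase _ _ _ hP19_11 hcl
    exact ⟨x, y, hx, hy, Or.inr (Or.inr (Or.inr (Or.inr (h))))⟩

/-- `11 ∣ f₃₆(7)`: `(7, 11, 36) ∈ 𝒞𝒮`. [cite: KimYamada2023, §6.1 (proof of Thm. B)] -/
theorem rep0_dvd_eval_csPoly_thirtysix : (11 : ℤ) ∣ (csPoly 36).eval 7 := by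
  rw [eval_csPoly]; norm_num

/-- `13 ∣ f₃₆(6)`: `(6, 13, 36) ∈ 𝒞𝒮`. [cite: KimYamada2023, §6.1 (proof of Thm. B)] -/
theorem rep1_dvd_eval_csPoly_thirtysix : (13 : ℤ) ∣ (csPoly 36).eval 6 := by
  rw [eval_csPoly]; norm_num

/-- `17 ∣ f₃₆(8)`: `(8, 17, 36) ∈ 𝒞𝒮`. [cite: KimYamada2023, §6.1 (proof of Thm. B)] -/
theorem rep2_dvd_eval_csPoly_thirtysix : (17 : ℤ) ∣ (csPoly 36).eval 8 := by
  rw [eval_csPoly]; norm_num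

/-- `19 ∣ f₃₆(11)`: `(11, 19, 36) ∈ 𝒞𝒮`. [cite: KimYamada2023, §6.1 (proof of Thm. B)] -/
theorem rep3_dvd_eval_csPoly_thirtysix : (19 : ℤ) ∣ (csPoly 36).eval 11 := by
  rw [eval_csPoly]; norm_num

/-- **Every Cappell–Shaneson matrix of trace `36` is similar to one of 5 standard matrices**
(Prop. 2.14). [cite: KimYamada2023, §6.1 (proof of Thm. B) and Prop. 2.14] -/
theorem isConj_standardCSMatrix_of_trace_eq_thirtysix (A : SL(3, ℤ))
    (hdet : ((A : Matrix (Fin 3) (Fin 3) ℤ) - 1).det = 1)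
    (htr : Matrix.trace (A : Matrix (Fin 3) (Fin 3) ℤ) = 36) :
    IsConj A (standardCSMatrix 1 1 36 (one_dvd _)) ∨
      IsConj A (standardCSMatrix 7 11 36 rep0_dvd_eval_csPoly_thirtysix) ∨
      IsConj A (standardCSMatrix 6 13 36 rep1_dvd_eval_csPoly_thirtysix) ∨
      IsConj A (standardCSMatrix 8 17 36 rep2_dvd_eval_csPoly_thirtysix) ∨
      IsConj A (standardCSMatrix 11 19 36 rep3_dvd_eval_csPoly_thirtysix) := by
  have hcover : ∀ J : Ideal (AdjoinRoot (csPoly 36)), J ≠ ⊥ →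
      ∃ (c d : ℤ) (_ : d ∣ (csPoly 36).eval c) (x y : AdjoinRoot (csPoly 36)),
        x ≠ 0 ∧ y ≠ 0 ∧ Ideal.span {x} * J = Ideal.span {y} * csIdeal c d 36 ∧
          ((c = 1 ∧ d = 1) ∨ (c = 7 ∧ d = 11) ∨ (c = 6 ∧ d = 13) ∨ (c = 8 ∧ d = 17) ∨ (c = 11 ∧ d = 19)) := by
    intro J hJ
    obtain ⟨x, y, hx, hy, hxy⟩ := ideal_class_adjoinRoot_thirtysix J hJ
    rcases hxy with h0 | h1 | h2 | h3 | h4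
    · exact ⟨1, 1, one_dvd _, x, y, hx, hy, h0, Or.inl ⟨rfl, rfl⟩⟩
    · exact ⟨7, 11, rep0_dvd_eval_csPoly_thirtysix, x, y, hx, hy, h1, Or.inr (Or.inl ⟨rfl, rfl⟩)⟩
    · exact ⟨6, 13, rep1_dvd_eval_csPoly_thirtysix, x, y, hx, hy, h2, Or.inr (Or.inr (Or.inl ⟨rfl, rfl⟩))⟩
    · exact ⟨8, 17, rep2_dvd_eval_csPoly_thirtysix, x, y, hx, hy, h3, Or.inr (Or.inr (Or.inr (Or.inl ⟨rfl, rfl⟩)))⟩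
    · exact ⟨11, 19, rep3_dvd_eval_csPoly_thirtysix, x, y, hx, hy, h4, Or.inr (Or.inr (Or.inr (Or.inr (⟨rfl, rfl⟩))))⟩
  obtain ⟨c, d, h, hconj, hcd⟩ := exists_isConj_standardCSMatrix_of_cover _ hcover A hdet htr
  rcases hcd with ⟨rfl, rfl⟩ | ⟨rfl, rfl⟩ | ⟨rfl, rfl⟩ | ⟨rfl, rfl⟩ | ⟨rfl, rfl⟩
  · exact Or.inl hconj
  · exact Or.inr (Or.inl hconj)
  · exact Or.inr (Or.inr (Or.inl hconj))
  · exact Or.inr (Or.inr (Or.inr (Or.inl hconj)))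
  · exact Or.inr (Or.inr (Or.inr (Or.inr (hconj))))

/-- **Kim–Yamada 2023, Theorem B for the trace `36`, PROVED**: the non-trivial classes move by
Gompf moves to the traces `3` (from `(7, 11, 36)`), `-3` (from `(6, 13, 36)`), `2` (from `(8, 17, 36)`), `-2` (from `(11, 19, 36)`), where Gompf's conjecture holds. [cite: KimYamada2023, Thm. B, Lemma 6.1 and §6.1] -/
theorem gompfConjectureForTrace_thirtysix : GompfConjectureForTrace 36 := by
  intro A hdet htr
  rcases isConj_standardCSMatrix_of_trace_eq_thirtysix A hdet htr with h0 | h1 | h2 | h3 | h4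
  · exact (GompfEquiv.of_isConj h0).trans (gompfEquiv_standardCSMatrix_one_one 34 (one_dvd _))
  · exact (GompfEquiv.of_isConj h1).trans
      (gompfEquiv_standardCSMatrix_akbulutKirbyMatrix_of_modEq
        (gompfConjectureForTrace_of_mem_Icc_neg_seven_twelve (by norm_num)) rep0_dvd_eval_csPoly_thirtysix
        (show (36 : ℤ) ≡ 3 [ZMOD 11] by decide))
  · exact (GompfEquiv.of_isConj h2).trans
      (gompfEquiv_standardCSMatrix_akbulutKirbyMatrix_of_modEq
        (gompfConjectureForTrace_of_mem_Icc_neg_seven_twelve (by norm_num)) rep1_dvd_eval_csPoly_thirtysix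
        (show (36 : ℤ) ≡ -3 [ZMOD 13] by decide))
  · exact (GompfEquiv.of_isConj h3).trans
      (gompfEquiv_standardCSMatrix_akbulutKirbyMatrix_of_modEq
        (gompfConjectureForTrace_of_mem_Icc_neg_seven_twelve (by norm_num)) rep2_dvd_eval_csPoly_thirtysix
        (show (36 : ℤ) ≡ 2 [ZMOD 17] by decide))
  · exact (GompfEquiv.of_isConj h4).trans
      (gompfEquiv_standardCSMatrix_akbulutKirbyMatrix_of_modEq
        (gompfConjectureForTrace_of_mem_Icc_neg_seven_twelve (by norm_num)) rep3_dvd_eval_csPoly_thirtysix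
        (show (36 : ℤ) ≡ -2 [ZMOD 19] by decide))

/-- **Theorem B for the trace `-31`** (`= 5 - 36`), by Theorem A. [cite: KimYamada2023, Thm. A and Thm. B] -/
theorem gompfConjectureForTrace_neg_thirtyone : GompfConjectureForTrace (-31) := by
  have h := gompfConjectureForTrace_of_five_sub gompfConjectureForTrace_thirtysix
  norm_num at h
  exact h

end Matrices


end Literature.Topology.FourManifolds

end
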